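import Summits.Ventures.CertifiedManyBodySolver.Rows.HomTorusLocalHamiltonian
import Literature.MathematicalPhysics.QuantumLattice.HubbardNNNHoppingLocalHamiltonian
import Literature.MathematicalPhysics.QuantumLattice.HubbardSpinFlipSymmetry
import HarnessLib

/-!
# `t–t'` Hubbard tori generated by an additive lattice map (Part I: model, diagonal bonds, the
# embedded diagonal local Hamiltonian)

HONEST FRAMING: first certified bounds; not a superconductivity verdict; every number certified or
labelled float. INFRASTRUCTURE for the kernel transport of `t–t'` window certificates (the data of the
tree's `groundEnergy_hubbardTorusTT'_div_ge_of_window_certificate`, interaction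
`hubbardTTPrimeFermionInteraction t t' U` of Xu et al. 2024 eq. (1)) to the tori generated by an additive
lattice map `φ : ℤ² →+ (ℤ/Nℤ)^{d'}` (`HomTorusModel`): the Chinese-remainder rings of the RECTANGULAR
periodic `3 × 4` / `3 × 5` tori, which cap the CAL ceiling classes `(≤3,4)` / `(≤3,5)` at `t' ≠ 0`.

The one idea: the DIAGONAL hops `±φ(e₁ ± e₂)` of the torus generated by `φ` are the nearest-neighbour
hops of the torus generated by `φ ∘ D`, `D : ℤ² →+ ℤ²` the additive map `e₀ ↦ e₁ + e₂ = j₀`,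
`e₁ ↦ e₁ − e₂ = j₁` (`diagMap`; `diagMap_unitVec`), so the diagonal hopping graph is
`homTorusGraph (φ.comp diagMap)` and all MODEL-level facts of `HomTorusModel` (symmetries, translation
invariance, neighbour sums under non-degenerate hops) apply verbatim. Contents:
* `diagMap`, `homSiteGraph_comp_diagMap_adj_iff` (`x ∼∼ y ↔ x ≠ y ∧ y = x ± φ j_s`);
* `homHubbardTT' φ t t' U := homHubbard φ t U + homHubbard (φ.comp diagMap) t' 0` — the `t–t'` Hubbard
  Hamiltonian of the torus generated by `φ` (for `φ = x ↦ x mod L` it is the tree's `hubbardTorusTT' L`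
  up to the identification of the two graphs; for `crtHom34 = (x ↦ 4x₀ + 9x₁ mod 12)` it is the `t–t'`
  model of the periodic `3 × 4` torus written on `ℤ/12`: hops `±4, ∓3` (`t`) and `±1, ∓5` (`t'`)),
  Hermitian, conserving `N̂`, `S^z`, every `(N, S^z)` sector, translation invariant, spin-exchange
  invariant;
* the WINDOW side for the embedding `x ↦ φ x` (`homEmb φ`, `φ` injective on the window `Λ'` only —
  sharp hypothesis): lattice diagonal bonds of `Λ'` are diagonal torus bonds
  (`homTorusDiag_adj_of_diagAdj`), a diagonal torus bond at the image of the inner region `Λ` (all four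
  diagonal neighbours in `Λ'`) comes from a lattice diagonal bond (`diagAdj_of_homTorusDiag_adj`), the
  far and the wrap-around diagonal hopping terms avoid the image of `Λ`
  (`far_diag_hopping_mem_carEvenSubalgebra_hom`, `wrapDiag_hopping_mem_carEvenSubalgebra_hom`), and the
  embedded local Hamiltonian of the diagonal interaction expands over the lattice diagonal bonds of `Λ'`
  (`fermionEmbed_homEmb_diag_localHamiltonian`, the tree's `fermionEmbed_toTorusEmb_diag_localHamiltonian`
  for `φ`).
Parts II–III (`HomTorusTTPrimeEnergyDensity`, `HomTorusTTPrimeCommutator`) and the theorem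
(`TorusCeilingTTPrimeHom`) follow; patterned on `HomTorusModel` / `HomTorusLocalHamiltonian` and the
tree's `HubbardNNNHoppingLocalHamiltonian`. [cite: XuEtAl2024, eq. (1)] [cite: Han2020Bootstrap, §3]
[cite: FriedliVelenik2017, §3.1] [cite: BratteliRobinsonII1997, §5.2.2]
-/

noncomputable section

open Matrix Finset
open Literature.MathematicalPhysics.QuantumLattice
open Literature.MathematicalPhysics.QuantumFieldTheory hiding Site
open Literature.MathematicalPhysics.QuantumManyBody.StateRelaxation
open Literature.Probability.LatticeModels
open HubbardWave0
open scoped ComplexOrder ComplexConjugate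

namespace Summit.Ventures.CertifiedManyBodySolver.Rows

/-! ### §1. The diagonal map `D` and the diagonal hopping graph `homTorusGraph (φ ∘ D)` -/

section DiagMap

/-- **The diagonal lattice map** `D : ℤ² →+ ℤ²`, `x ↦ (x₀ + x₁, x₀ − x₁)`, i.e. `e₀ ↦ j₀ = (1, 1)`,
`e₁ ↦ j₁ = (1, −1)`: the nearest-neighbour vectors go to the diagonal vectors `diagVec`. [folklore] -/
def diagMap : Site 2 →+ Site 2 where
  toFun x := fun i => if i = 0 then x 0 + x 1 else x 0 - x 1
  map_zero' := by
    funext i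
    split_ifs <;> simp
  map_add' x y := by
    funext i
    simp only [Pi.add_apply]
    split_ifs <;> ring

/-- `D x = (x₀ + x₁, x₀ − x₁)`. [folklore] -/
theorem diagMap_apply (x : Site 2) (i : Fin 2) : diagMap x i = if i = 0 then x 0 + x 1 else x 0 - x 1 := rfl

/-- `D eₛ = j_s` (`j₀ = e₁ + e₂`, `j₁ = e₁ − e₂`). [folklore] -/
theorem diagMap_unitVec (s : Fin 2) : diagMap (unitVec s) = diagVec s := by
  funext i
  rw [diagMap_apply, diagVec]
  fin_cases s <;> fin_cases i <;> simp

variable {d' N : ℕ} (φ : Site 2 →+ TorusSite d' N)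

/-- The hops of `φ ∘ D` are the diagonal hops `φ j_s`. [folklore] -/
theorem comp_diagMap_unitVec (s : Fin 2) : φ.comp diagMap (unitVec s) = φ (diagVec s) := by
  rw [AddMonoidHom.comp_apply, diagMap_unitVec]

/-- **The diagonal hopping graph of the torus generated by `φ`** is the torus graph generated by
`φ ∘ D`: `x ∼∼ y ↔ x ≠ y ∧ (y = x ± φ j_s for some s)` (for `φ = x ↦ x mod L` the tree's
`torusDiagGraph L`). [cite: XuEtAl2024, eq. (1)] -/
theorem homSiteGraph_comp_diagMap_adj_iff (x y : TorusSite d' N) :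
    (homSiteGraph (φ.comp diagMap)).Adj x y ↔
      x ≠ y ∧ ∃ s : Fin 2, y = x + φ (diagVec s) ∨ x = y + φ (diagVec s) := by
  simp only [homSiteGraph_adj_iff, comp_diagMap_unitVec]

end DiagMap

/-! ### §2. The `t–t'` Hamiltonian of the torus generated by `φ` and its symmetries -/

section Model

variable {d' N : ℕ} (φ : Site 2 →+ TorusSite d' N)

/-- **The `t–t'` Hubbard Hamiltonian of the torus generated by `φ : ℤ² →+ (ℤ/Nℤ)^{d'}`**:
`H^{tt'}_φ = −t Σ_{x∼y,σ} c†c − t' Σ_{x∼∼y,σ} c†c + U Σ n↑n↓` with `x ∼ y ↔ y = x ± φ(eᵢ)` and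
`x ∼∼ y ↔ y = x ± φ(e₁ ± e₂)`, i.e. `homHubbard φ t U + homHubbard (φ ∘ D) t' 0` (Xu et al. 2024
eq. (1) on the torus generated by `φ`; CRT rings of rectangular periodic tori included).
[cite: XuEtAl2024, eq. (1)] -/
def homHubbardTT' (t t' U : ℝ) : Matrix (Finset (Orb (FermionTorus d' N))) (Finset (Orb (FermionTorus d' N))) ℂ :=
  homHubbard φ t U + homHubbard (φ.comp diagMap) t' 0

/-- `H^{tt'}_φ` is Hermitian. [cite: XuEtAl2024, eq. (1)] -/
theorem homHubbardTT'_isHermitian (t t' U : ℝ) : (homHubbardTT' φ t t' U).IsHermitian :=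
  (homHubbard_isHermitian φ t U).add (homHubbard_isHermitian _ t' 0)

/-- `H^{tt'}_φ` conserves the particle number. [cite: XuEtAl2024, eq. (1)] -/
theorem homHubbardTT'_commute_totalNumber (t t' U : ℝ) :
    Commute (homHubbardTT' φ t t' U) (totalNumber : Matrix (Finset (Orb (FermionTorus d' N))) _ ℂ) :=
  (homHubbard_commute_totalNumber φ t U).add_left (homHubbard_commute_totalNumber _ t' 0)

/-- `H^{tt'}_φ` conserves `S^z`. [cite: XuEtAl2024, eq. (1)] -/
theorem homHubbardTT'_commute_spinZ (t t' U : ℝ) :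
    Commute (homHubbardTT' φ t t' U) (HubbardWave0.spinZ : Matrix (Finset (Orb (FermionTorus d' N))) _ ℂ) :=
  (homHubbard_commute_spinZ φ t U).add_left (homHubbard_commute_spinZ _ t' 0)

/-- `H^{tt'}_φ` preserves the joint `(N, S^z)` sectors. [cite: LiebPRL1989] -/
theorem mulVec_homHubbardTT'_mem_szSector (t t' U : ℝ) {n : ℕ} {M : ℝ}
    {ψ : Fock (Orb (FermionTorus d' N))} (hψ : ψ ∈ szSector n M) : homHubbardTT' φ t t' U *ᵥ ψ ∈ szSector n M :=
  mulVec_mem_szSector_of_commute (homHubbardTT'_commute_totalNumber φ t t' U) (homHubbardTT'_commute_spinZ φ t t' U) hψ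

/-- **The spin exchange fixes `H^{tt'}_φ`** (both hopping graphs and the repulsion are spin blind).
[cite: LiebPRL1989, proof of Theorem 1] -/
theorem relabel_spinSwap_homHubbardTT' (t t' U : ℝ) :
    relabel (Orb.spinSwap : Orb (FermionTorus d' N) ≃ Orb (FermionTorus d' N)) (homHubbardTT' φ t t' U) =
      homHubbardTT' φ t t' U := by
  rw [homHubbardTT', relabel_add, homHubbard, homHubbard, relabel_spinSwap_hamiltonian, relabel_spinSwap_hamiltonian]

variable [NeZero N]

/-- **Translation invariance**: `T_v H^{tt'}_φ T_v⁻¹ = H^{tt'}_φ`. [cite: XuEtAl2024, eq. (1)] -/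
theorem relabel_translate_homHubbardTT' (v : TorusSite d' N) (t t' U : ℝ) :
    relabel (Orb.translate v) (homHubbardTT' φ t t' U) = homHubbardTT' φ t t' U := by
  rw [homHubbardTT', relabel_add, relabel_translate_homHubbard, relabel_translate_homHubbard]

/-- `U_v H^{tt'}_φ = H^{tt'}_φ U_v` for the translation unitaries. [folklore] -/
theorem fockTranslate_mul_homHubbardTT' (v : TorusSite d' N) (t t' U : ℝ) :
    (fockTranslate v).val * homHubbardTT' φ t t' U = homHubbardTT' φ t t' U * (fockTranslate v).val := by
  rw [homHubbardTT', mul_add, add_mul, fockTranslate_mul_homHubbard, fockTranslate_mul_homHubbard]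

end Model

/-! ### §3. Lattice diagonal bonds versus diagonal torus bonds (`φ` injective on the window) -/

section Bonds

variable {d' N : ℕ} [NeZero N] (φ : Site 2 →+ TorusSite d' N)

/-- **Lattice diagonal neighbours in the window are diagonal torus neighbours**: for `y = x ± j_s` with
`x, y ∈ Λ'` and `φ` injective on `Λ'`, `φ x ∼∼ φ y`. [cite: FriedliVelenik2017, §3.1] -/
theorem homTorusDiag_adj_of_diagAdj {Λ' : Finset (Site 2)} (hInj : Set.InjOn φ ↑Λ') {x y : Site 2}
    (hx : x ∈ Λ') (hy : y ∈ Λ') (hxy : (∃ s : Fin 2, y = x + diagVec s) ∨ ∃ s : Fin 2, x = y + diagVec s) :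
    (homTorusGraph (φ.comp diagMap)).Adj (FermionTorus.ofTorusSite (φ x)) (FermionTorus.ofTorusSite (φ y)) := by
  rw [homTorusGraph_adj_ofTorusSite, homSiteGraph_comp_diagMap_adj_iff]
  refine ⟨fun h => ?_, ?_⟩
  · have hxy' : x = y := hInj hx hy h
    rcases hxy with ⟨s, hs⟩ | ⟨s, hs⟩
    · exact self_ne_add_diagVec x s (hxy'.trans hs)
    · exact self_ne_add_diagVec y s (hxy'.symm.trans hs)
  · rcases hxy with ⟨s, hs⟩ | ⟨s, hs⟩
    · exact ⟨s, Or.inl (by rw [hs, map_add])⟩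
    · exact ⟨s, Or.inr (by rw [hs, map_add])⟩

/-- **A diagonal torus bond at the image of the inner region comes from a lattice diagonal bond**: if
`x ∈ Λ`, all four diagonal neighbours of `x` lie in `Λ'`, `y ∈ Λ'`, `φ` is injective on `Λ'` and
`φ x ∼∼ φ y`, then `y = x ± j_s`. [cite: FriedliVelenik2017, §3.1] -/
theorem diagAdj_of_homTorusDiag_adj {Λ Λ' : Finset (Site 2)}
    (hclosedD : ∀ x ∈ Λ, ∀ s : Fin 2, x + diagVec s ∈ Λ' ∧ x - diagVec s ∈ Λ')
    (hInj : Set.InjOn φ ↑Λ') {x y : Site 2} (hx : x ∈ Λ) (hy : y ∈ Λ')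
    (hadj : (homTorusGraph (φ.comp diagMap)).Adj (FermionTorus.ofTorusSite (φ x)) (FermionTorus.ofTorusSite (φ y))) :
    (∃ s : Fin 2, y = x + diagVec s) ∨ ∃ s : Fin 2, x = y + diagVec s := by
  rw [homTorusGraph_adj_ofTorusSite, homSiteGraph_comp_diagMap_adj_iff] at hadj
  obtain ⟨-, s, hs | hs⟩ := hadj
  · refine Or.inl ⟨s, hInj hy (hclosedD x hx s).1 ?_⟩
    rw [hs, map_add]
  · have hy' : y = x - diagVec s :=
      hInj hy (hclosedD x hx s).2 (by rw [map_sub, hs, add_sub_cancel_right])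
    exact Or.inr ⟨s, by rw [hy']; exact (sub_add_cancel x _).symm⟩

/-- A site of the window whose image is the image of an inner site is that inner site (restated from
`mem_of_hom_mem_image` for `d = 2`). [folklore] -/
theorem mem_image_of_homTorusDiag_adj {Λ Λ' : Finset (Site 2)}
    (hclosedD : ∀ x ∈ Λ, ∀ s : Fin 2, x + diagVec s ∈ Λ' ∧ x - diagVec s ∈ Λ') {x : Site 2} (hx : x ∈ Λ)
    {b : FermionTorus d' N} (hab : (homTorusGraph (φ.comp diagMap)).Adj (FermionTorus.ofTorusSite (φ x)) b) :
    b ∈ Λ'.image fun y => FermionTorus.ofTorusSite (φ y) := by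
  rw [homTorusGraph_adj, FermionTorus.toTorusSite_ofTorusSite, homSiteGraph_comp_diagMap_adj_iff] at hab
  obtain ⟨-, s, hs | hs⟩ := hab
  · refine Finset.mem_image.2 ⟨x + diagVec s, (hclosedD x hx s).1, ?_⟩
    rw [map_add, ← hs, FermionTorus.ofTorusSite_toTorusSite]
  · refine Finset.mem_image.2 ⟨x - diagVec s, (hclosedD x hx s).2, ?_⟩
    rw [map_sub, hs, add_sub_cancel_right, FermionTorus.ofTorusSite_toTorusSite]

/-- If a diagonal torus bond `c ∼∼ c'` starts in the image of `Λ`, both ends lie in the image of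
`Λ' ⊇ Λ` (all diagonal neighbours of `Λ` in `Λ'`). [cite: FriedliVelenik2017, §3.1] -/
theorem mem_image_and_mem_image_of_homTorusDiag_adj {Λ Λ' : Finset (Site 2)} (hΛ : Λ ⊆ Λ')
    (hclosedD : ∀ x ∈ Λ, ∀ s : Fin 2, x + diagVec s ∈ Λ' ∧ x - diagVec s ∈ Λ')
    {c c' : FermionTorus d' N} (hcc' : (homTorusGraph (φ.comp diagMap)).Adj c c')
    (hc : c ∈ Λ.image fun x => FermionTorus.ofTorusSite (φ x)) :
    c ∈ Λ'.image (fun x => FermionTorus.ofTorusSite (φ x)) ∧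
      c' ∈ Λ'.image (fun x => FermionTorus.ofTorusSite (φ x)) := by
  obtain ⟨x, hx, rfl⟩ := Finset.mem_image.1 hc
  exact ⟨Finset.mem_image.2 ⟨x, hΛ hx, rfl⟩, mem_image_of_homTorusDiag_adj φ hclosedD hx hcc'⟩

/-- **The far diagonal hopping terms are even and supported away from the image of `Λ`.**
[cite: BratteliRobinsonII1997, §5.2.2] -/
theorem far_diag_hopping_mem_carEvenSubalgebra_hom {Λ Λ' : Finset (Site 2)} (hΛ : Λ ⊆ Λ')
    (hclosedD : ∀ x ∈ Λ, ∀ s : Fin 2, x + diagVec s ∈ Λ' ∧ x - diagVec s ∈ Λ') :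
    (∑ a : FermionTorus d' N, ∑ b : FermionTorus d' N,
        (if ¬(a ∈ Λ'.image (fun x => FermionTorus.ofTorusSite (φ x)) ∧
            b ∈ Λ'.image (fun x => FermionTorus.ofTorusSite (φ x))) then
          ∑ σ : Fin 2, (if (homTorusGraph (φ.comp diagMap)).Adj a b then creation (orb a σ) * annihilation (orb b σ) else 0)
        else 0)) ∈
      carEvenSubalgebra (orbs (Λ.image fun x => FermionTorus.ofTorusSite (φ x)))ᶜ := by
  refine sum_mem fun a _ => sum_mem fun b _ => ?_
  by_cases hab : ¬(a ∈ Λ'.image (fun x => FermionTorus.ofTorusSite (φ x)) ∧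
      b ∈ Λ'.image (fun x => FermionTorus.ofTorusSite (φ x)))
  · rw [if_pos hab]
    refine sum_ite_homTorusGraph_adj_mem_carEvenSubalgebra (φ.comp diagMap) fun hadj =>
      ⟨fun ha => hab ?_, fun hb => hab ?_⟩
    · exact mem_image_and_mem_image_of_homTorusDiag_adj φ hΛ hclosedD hadj ha
    · exact (mem_image_and_mem_image_of_homTorusDiag_adj φ hΛ hclosedD hadj.symm hb).symm
  · rw [if_neg hab]
    exact zero_mem _

/-- **The wrap-around diagonal bonds avoid the image of the inner region**: the hopping terms of the
diagonal torus bonds `φ x ∼∼ φ y` between image sites of `Λ'` that are NOT images of lattice diagonal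
bonds lie in the even CAR subalgebra of the orbitals away from the image of `Λ`, whenever every
diagonal neighbour of `Λ` is in `Λ'` and `φ` is injective on `Λ'`. [cite: BratteliRobinsonII1997, §5.2.2] -/
theorem wrapDiag_hopping_mem_carEvenSubalgebra_hom {Λ Λ' : Finset (Site 2)} (hΛ : Λ ⊆ Λ')
    (hclosedD : ∀ x ∈ Λ, ∀ s : Fin 2, x + diagVec s ∈ Λ' ∧ x - diagVec s ∈ Λ')
    (hInj : Set.InjOn φ ↑Λ') :
    (∑ x ∈ Λ', ∑ y ∈ Λ',
        (if (homTorusGraph (φ.comp diagMap)).Adj (FermionTorus.ofTorusSite (φ x)) (FermionTorus.ofTorusSite (φ y)) ∧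
              ¬((∃ s : Fin 2, y = x + diagVec s) ∨ ∃ s : Fin 2, x = y + diagVec s) then
          ∑ σ : Fin 2, creation (orb (FermionTorus.ofTorusSite (φ x)) σ) *
            annihilation (orb (FermionTorus.ofTorusSite (φ y)) σ)
        else 0)) ∈
      carEvenSubalgebra (orbs (Λ.image fun x => FermionTorus.ofTorusSite (φ x)))ᶜ := by
  refine sum_mem fun x hx => sum_mem fun y hy => ?_
  by_cases h : (homTorusGraph (φ.comp diagMap)).Adj (FermionTorus.ofTorusSite (φ x)) (FermionTorus.ofTorusSite (φ y)) ∧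
      ¬((∃ s : Fin 2, y = x + diagVec s) ∨ ∃ s : Fin 2, x = y + diagVec s)
  · rw [if_pos h]
    have hxΛ : FermionTorus.ofTorusSite (φ x) ∉ Λ.image fun z => FermionTorus.ofTorusSite (φ z) := fun hmem =>
      h.2 (diagAdj_of_homTorusDiag_adj φ hclosedD hInj (mem_of_hom_mem_image φ hΛ hInj hx hmem) hy h.1)
    have hyΛ : FermionTorus.ofTorusSite (φ y) ∉ Λ.image fun z => FermionTorus.ofTorusSite (φ z) := fun hmem =>
      h.2 (diagAdj_of_homTorusDiag_adj φ hclosedD hInj (mem_of_hom_mem_image φ hΛ hInj hy hmem) hx h.1.symm).symm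
    exact sum_mem fun σ _ => creation_mul_annihilation_mem_carEvenSubalgebra
      (Finset.mem_compl.2 fun h' => hxΛ (orb_mem_orbs.1 h'))
      (Finset.mem_compl.2 fun h' => hyΛ (orb_mem_orbs.1 h'))
  · rw [if_neg h]
    exact zero_mem _

end Bonds

/-! ### §4. The embedded local Hamiltonian of the diagonal interaction -/

section LocalHamiltonian

variable {d' N : ℕ} [NeZero N] (φ : Site 2 →+ TorusSite d' N) (t' : ℝ)

/-- **The embedded local Hamiltonian of the diagonal interaction, expanded**: `Γ_φ(H^{t'}_{Λ'})` is the
diagonal hopping Hamiltonian of the image bonds, `-t' Σ_{x ∼∼ y ∈ Λ'} Σ_σ c†_{φ x,σ} c_{φ y,σ}` (the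
tree's `fermionEmbed_toTorusEmb_diag_localHamiltonian` for the embedding `x ↦ φ x`).
[cite: XuEtAl2024, eq. (1)] -/
theorem fermionEmbed_homEmb_diag_localHamiltonian {Λ' : Finset (Site 2)} (h : Set.InjOn φ ↑Λ') :
    fermionEmbed (homEmb φ h) ((diagHoppingFermionInteraction t').localHamiltonian Λ') =
      -(t' : ℂ) • ∑ x ∈ Λ', ∑ y ∈ Λ', (if ((∃ s : Fin 2, y = x + diagVec s) ∨ ∃ s : Fin 2, x = y + diagVec s) then
          ∑ σ : Fin 2, creation (orb (FermionTorus.ofTorusSite (φ x)) σ) *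
            annihilation (orb (FermionTorus.ofTorusSite (φ y)) σ) else 0) := by
  classical
  set hop : Site 2 → Site 2 → Matrix (Finset (Orb (FermionTorus d' N))) (Finset (Orb (FermionTorus d' N))) ℂ :=
    fun x y => ∑ σ : Fin 2, creation (orb (FermionTorus.ofTorusSite (φ x)) σ) *
      annihilation (orb (FermionTorus.ofTorusSite (φ y)) σ) with hhop
  -- images of the generators under `Γ(ι ∘ incl)`
  have hc : ∀ {X : Finset (Site 2)} (hX : X ⊆ Λ') (x : Site 2) (hx : x ∈ X) (σ : Fin 2),
      fermionEmbed ((PolySite.incl hX).trans (homEmb φ h)) (cAt x hx σ) =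
        annihilation (orb (FermionTorus.ofTorusSite (φ x)) σ) := by
    intro X hX x hx σ
    rw [cAt, fermionEmbed_annihilation]
    rfl
  have hcd : ∀ {X : Finset (Site 2)} (hX : X ⊆ Λ') (x : Site 2) (hx : x ∈ X) (σ : Fin 2),
      fermionEmbed ((PolySite.incl hX).trans (homEmb φ h)) ((cAt x hx σ)ᴴ) =
        creation (orb (FermionTorus.ofTorusSite (φ x)) σ) := by
    intro X hX x hx σ
    rw [cAt, annihilation_conjTranspose, fermionEmbed_creation]
    rfl
  -- (1) the left-hand side over the diagonal bonds of `Λ'`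
  have hL : fermionEmbed (homEmb φ h) ((diagHoppingFermionInteraction t').localHamiltonian Λ') =
      -(t' : ℂ) • ∑ x ∈ Λ', ∑ s : Fin 2,
        (if x + diagVec s ∈ Λ' then hop x (x + diagVec s) + hop (x + diagVec s) x else 0) := by
    rw [FermionInteraction.localHamiltonian_eq_sum, fermionEmbed_sum,
      sum_powerset_eq_of_diag_support Λ' _ (fun X hX => by
        by_cases h' : X ⊆ Λ'
        · rw [dif_pos h', diagHoppingFermionInteraction_apply_eq_zero t' hX, fermionEmbed_zero, fermionEmbed_zero]
        · rw [dif_neg h', fermionEmbed_zero]),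
      Finset.sum_filter, Finset.sum_product, Finset.smul_sum]
    refine Finset.sum_congr rfl fun x hx => ?_
    rw [Finset.smul_sum]
    refine Finset.sum_congr rfl fun s _ => ?_
    by_cases hs : x + diagVec s ∈ Λ'
    · have hsub : ({x, x + diagVec s} : Finset (Site 2)) ⊆ Λ' := insert_subset hx (singleton_subset_iff.2 hs)
      rw [if_pos hs, if_pos hs, dif_pos hsub, fermionEmbed_fermionEmbed, diagHoppingFermionInteraction_apply_pair,
        fermionEmbed_smul, fermionEmbed_sum, hhop]
      simp only [← Finset.sum_add_distrib]
      congr 1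
      refine Finset.sum_congr rfl fun σ _ => ?_
      rw [fermionEmbed_add, fermionEmbed_mul, fermionEmbed_mul, hc, hc, hcd, hcd]
    · rw [if_neg hs, if_neg hs, smul_zero]
  -- (2) the right-hand side over the diagonal bonds of `Λ'`
  have hR : ∑ x ∈ Λ', ∑ y ∈ Λ', (if ((∃ s : Fin 2, y = x + diagVec s) ∨ ∃ s : Fin 2, x = y + diagVec s) then hop x y else 0) =
      ∑ x ∈ Λ', ∑ s : Fin 2, (if x + diagVec s ∈ Λ' then hop x (x + diagVec s) + hop (x + diagVec s) x else 0) := by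
    simp_rw [ite_diagAdj_eq_sum]
    have hswap : ∀ x : Site 2,
        ∑ y ∈ Λ', ∑ s : Fin 2, ((if y = x + diagVec s then hop x y else 0) +
            (if x = y + diagVec s then hop x y else 0)) =
          ∑ s : Fin 2, ∑ y ∈ Λ', ((if y = x + diagVec s then hop x y else 0) +
            (if x = y + diagVec s then hop x y else 0)) := fun x => Finset.sum_comm
    simp_rw [hswap]
    rw [Finset.sum_comm]
    conv_rhs => rw [Finset.sum_comm]
    refine Finset.sum_congr rfl fun s _ => ?_
    simp only [Finset.sum_add_distrib]
    have h1 : ∀ x : Site 2, ∑ y ∈ Λ', (if y = x + diagVec s then hop x y else 0) =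
        if x + diagVec s ∈ Λ' then hop x (x + diagVec s) else 0 := fun x => by
      rw [Finset.sum_ite_eq' Λ' (x + diagVec s) (fun y => hop x y)]
    have h2 : ∑ x ∈ Λ', ∑ y ∈ Λ', (if x = y + diagVec s then hop x y else 0) =
        ∑ y ∈ Λ', if y + diagVec s ∈ Λ' then hop (y + diagVec s) y else 0 := by
      rw [Finset.sum_comm]
      exact Finset.sum_congr rfl fun y _ => by rw [Finset.sum_ite_eq' Λ' (y + diagVec s) (fun x => hop x y)]
    simp_rw [h1]
    rw [h2, ← Finset.sum_add_distrib]
    refine Finset.sum_congr rfl fun x _ => ?_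
    by_cases h' : x + diagVec s ∈ Λ'
    · rw [if_pos h', if_pos h', if_pos h']
    · rw [if_neg h', if_neg h', if_neg h', add_zero]
  rw [hL, hR]

end LocalHamiltonian

end Summit.Ventures.CertifiedManyBodySolver.Rows

end
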